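import Literature.Analysis.FunctionSpaces.DuBoisReymondAE
import Literature.MathematicalPhysics.QuantumManyBody.MarginalSturmComparison
import Literature.MathematicalPhysics.QuantumManyBody.MarginalSturmTestMonotone
import Literature.MathematicalPhysics.QuantumManyBody.MarginalSturmWronskian
import HarnessLib

/-!
# The marginal Sturm package: the wall-flux bound `∫₀^σ et ≤ 8 μ^{3/2} η σ`

Topic `Literature/MathematicalPhysics/QuantumManyBody` (namespace
`Literature.MathematicalPhysics.QuantumManyBody.BoseGas`, sub-namespace `MarginalSturm`). Assembly
of the one-dimensional real analysis behind the near-wall energy bound of the crux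
`RigidMomentumBound` (`AtomisticToContinuum/BoseEinsteinCondensation`, stub `stub_sturmPackage`).
Think of `m(s)` as the
mass of the one-coordinate marginal of a Dirichlet ground state at distance `s` from a wall,
`p = m'`, `et` the normal kinetic energy on the slice, `e` the full slice energy, `E'` the energy,
`E₁` the energy of the other particles, `μ ≥ E' - E₁`, `η` the mass within half a period
`π/√μ` of the wall.

* `MarginalSturm.integral_le_of_weak_subsolution` — **regular data**: `ω > 0`, `π/ω ≤ S`, `m` with
  continuous derivative `p`, `m(0) = 0`, `m ≥ 0` on `[0, S]`, `0 ≤ et`, `p² ≤ 4 m·et` a.e., the weak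
  subsolution inequality `∫₀^S g·et + ½∫₀^S g'·p ≤ ω² ∫₀^S g·m` (`C¹` `g ≥ 0`), `∫₀^{π/ω} m ≤ η`
  ⟹ `∫₀^σ et ≤ (4 + 2π/3) ω³ η σ` for `0 < σ ≤ π/(4ω)`. Route: Wronskian monotonicity
  (`integral_deriv_mul_wronskian_nonpos` + `le_of_forall_integral_deriv_mul_nonpos`) ⟹
  `wall_wronskian_nonneg` ⟹ `m/sin²(ω·)` nondecreasing ⟹ `m(s) ≤ Φs²`, `Φ = 4ω³η/π`, and `p ≥ 0` on
  `(0, π/(2ω)]`; then test the weak inequality with the `C¹` wall profile of `BoseGasWallCutoff`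
  (`1` on `[0, σ]`, `0` on `[2σ, ∞)`, `|slope| ≤ π/(2σ)`):
  `∫₀^σ et ≤ ω² ∫₀^{2σ} m + (π/(4σ)) m(2σ) ≤ Φσ(π²/6 + π)`.
* `MarginalSturm.exists_continuous_slope` — **du Bois-Reymond step**: if `m` is continuous on
  `[0, S]`, `m = ∫₀ p`, and `∫₀^S g e + ½∫₀^S g' p = E' ∫₀^S g m` for all `C¹` `g`, then `p` has the
  continuous representative `2∫₀(e - E'm)` and `m` is `C¹` on `[0, S]` (tree lemma
  `Literature.Analysis.FunctionSpaces.ae_eq_add_setIntegral_of_forall_test`).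
* `MarginalSturm.integral_normalKinetic_le` — **the package in the weak form delivered by the
  many-body problem** (hypotheses on `m, p, et, e, E', E₁, μ, η, S` exactly as in the stub;
  conclusion `∫₀^σ et ≤ 8 μ √μ η σ` for `0 < σ ≤ π/(4√μ)`).

On the exact profile `m = (2/π) sin²`, `et = e = (2/π) cos²`, `μ = E' = 1`, `E₁ = 0`, `S = π` every
hypothesis is an equality and `∫₀^σ et ≤ (2/π)σ`. Tagged folklore (Sturm 1836, Picone 1910, in
weak form). Deliberately NOT here: the sharp constant (`≈ 1.54`), the matched interior comparison.
-/

noncomputable section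

namespace Literature.MathematicalPhysics.QuantumManyBody.BoseGas

open _root_.MeasureTheory _root_.Filter _root_.Set _root_.Real intervalIntegral
open scoped Topology

namespace MarginalSturm

/-- **The wall-flux bound for regular data.** Let `ω > 0`, `π/ω ≤ S`, `p` continuous, `m' = p`
everywhere, `m 0 = 0`, `m ≥ 0` on `[0, S]`, `et` integrable on `[0, S]` with `0 ≤ et` and
`p² ≤ 4 m·et` a.e., the weak subsolution inequality `∫₀^S g·et + ½∫₀^S g'·p ≤ ω² ∫₀^S g·m` for
all `C¹` `g ≥ 0`, and `∫₀^{π/ω} m ≤ η`. Then `∫₀^σ et ≤ (4 + 2π/3) ω³ η σ` for `0 < σ ≤ π/(4ω)`.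
Proof: the Wronskian comparison with `sin(ω·)` (`integral_deriv_mul_wronskian_nonpos`,
`le_of_forall_integral_deriv_mul_nonpos`, `wall_wronskian_nonneg`) makes `m/sin²(ω·)` nondecreasing
on `(0, π/ω)` and `p ≥ 0` on `(0, π/(2ω)]`, whence `m(s) ≤ Φ s²` with `Φ = 4ω³η/π`
(`le_integral_mul_sq_of_monotoneOn`); testing the inequality with the `C¹` wall profile equal to `1`
on `[0, σ]` and `0` on `[2σ, ∞)` (slope `≤ π/(2σ)` in absolute value) gives
`∫₀^σ et ≤ ω² ∫₀^{2σ} m + (π/(4σ)) m(2σ) ≤ Φσ (π²/6 + π)`. [folklore] -/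
theorem integral_le_of_weak_subsolution {ω S η : ℝ} {m p et : ℝ → ℝ} (hω : 0 < ω)
    (hS : π / ω ≤ S) (hp : Continuous p) (hm : ∀ x, HasDerivAt m (p x) x) (hm0 : m 0 = 0)
    (hmnn : ∀ x ∈ Icc 0 S, 0 ≤ m x) (het : IntegrableOn et (Icc 0 S))
    (hae : ∀ᵐ x ∂(volume.restrict (Icc 0 S)), 0 ≤ et x ∧ p x ^ 2 ≤ 4 * m x * et x)
    (hineq : ∀ g : ℝ → ℝ, ContDiff ℝ 1 g → (∀ x, 0 ≤ g x) →
      (∫ x in (0 : ℝ)..S, g x * et x) + (1 / 2) * (∫ x in (0 : ℝ)..S, deriv g x * p x) ≤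
        ω ^ 2 * ∫ x in (0 : ℝ)..S, g x * m x)
    (hη : ∫ x in (0 : ℝ)..(π / ω), m x ≤ η) {σ : ℝ} (hσ : 0 < σ) (hσ' : σ ≤ π / (4 * ω)) :
    ∫ x in (0 : ℝ)..σ, et x ≤ (4 + 2 * π / 3) * ω ^ 3 * η * σ := by
  have hmc : Continuous m := continuous_iff_continuousAt.2 fun x => (hm x).continuousAt
  have hL : 0 < π / ω := div_pos pi_pos hω
  have h4L : π / (4 * ω) < π / (2 * ω) := by
    rw [div_lt_div_iff_of_pos_left pi_pos (by positivity) (by positivity)]; linarith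
  have h2L : π / (2 * ω) < π / ω := by
    rw [div_lt_div_iff_of_pos_left pi_pos (by positivity) hω]; linarith
  -- Step 1: local Wronskian monotonicity
  have hmono : ∀ a b : ℝ, 0 < a → a < b → b < π / ω → (∀ x ∈ Icc a b, 0 < m x) →
      p a * sin (ω * a) / (2 * sqrt (m a)) - sqrt (m a) * (ω * cos (ω * a)) ≤
        p b * sin (ω * b) / (2 * sqrt (m b)) - sqrt (m b) * (ω * cos (ω * b)) := by
    intro a b ha hab hb hpos
    have hq2 : ∀ x ∈ Icc a b, 2 * sqrt (m x) ≠ 0 := fun x hx =>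
      mul_ne_zero two_ne_zero (sqrt_ne_zero'.2 (hpos x hx))
    have hsq : Continuous fun x => sqrt (m x) := hmc.sqrt
    refine le_of_forall_integral_deriv_mul_nonpos
      (W := fun x => p x * sin (ω * x) / (2 * sqrt (m x)) - sqrt (m x) * (ω * cos (ω * x)))
      hab (by fun_prop (disch := assumption)) fun g hg hg0 hga hgb => ?_
    exact integral_deriv_mul_wronskian_nonpos hω ha.le hab (hb.le.trans hS) hb.le hp hm hpos
      het hae hineq hg hg0 hga hgb
  -- Step 2: `V ≥ 0`, monotonicity of `m / sin²`, the quadratic bound, `p ≥ 0`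
  have hV : ∀ c ∈ Ioo 0 (π / ω), 0 ≤ p c * sin (ω * c) - 2 * m c * (ω * cos (ω * c)) :=
    fun c hc => wall_wronskian_nonneg hω hS hm hm0 hmnn hmono hc
  have hR := monotoneOn_div_sin_sq hω hm hV
  have hη0 : 0 ≤ η := (integral_nonneg hL.le fun x hx => hmnn x ⟨hx.1, hx.2.trans hS⟩).trans hη
  set Φ : ℝ := 4 * ω / π * η * ω ^ 2 with hΦ
  have hΦnn : 0 ≤ Φ := by positivity
  have hmsq : ∀ s ∈ Icc 0 (π / (2 * ω)), m s ≤ Φ * s ^ 2 := by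
    intro s hs
    rcases hs.1.eq_or_lt with h | h
    · rw [← h, hm0]; simp
    have h1 := le_integral_mul_sq_of_monotoneOn hω hmc (fun x hx => hmnn x ⟨hx.1, hx.2.trans hS⟩)
      hR ⟨h, hs.2⟩
    have h2 : 4 * ω / π * (∫ x in (0 : ℝ)..(π / ω), m x) * (ω * s) ^ 2 ≤
        4 * ω / π * η * (ω * s) ^ 2 :=
      mul_le_mul_of_nonneg_right (mul_le_mul_of_nonneg_left hη (by positivity)) (sq_nonneg _)
    calc m s ≤ 4 * ω / π * η * (ω * s) ^ 2 := h1.trans h2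
      _ = Φ * s ^ 2 := by rw [hΦ]; ring
  have hpnn : ∀ c ∈ Ioc 0 (π / (2 * ω)), 0 ≤ p c := by
    intro c hc
    have hc' : c ∈ Ioo 0 (π / ω) := ⟨hc.1, hc.2.trans_lt h2L⟩
    have hsin : 0 < sin (ω * c) :=
      sin_pos_of_pos_of_lt_pi (mul_pos hω hc.1) (by rw [← lt_div_iff₀' hω]; exact hc'.2)
    have hcos : 0 ≤ cos (ω * c) := cos_nonneg_of_neg_pi_div_two_le_of_le
      (by linarith [mul_pos hω hc.1, pi_pos])
      (by rw [le_div_iff₀ (two_pos), mul_comm, ← mul_assoc, ← le_div_iff₀' (by positivity)];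
          exact hc.2)
    have h1 := hV c hc'
    have h2 : 0 ≤ 2 * m c * (ω * cos (ω * c)) :=
      mul_nonneg (mul_nonneg two_pos.le (hmnn c ⟨hc.1.le, hc'.2.le.trans hS⟩))
        (mul_nonneg hω.le hcos)
    exact nonneg_of_mul_nonneg_left (by linarith) hsin
  -- Step 3: the test function (wall profile `1` on `(-∞, σ]`, `0` on `[2σ, ∞)`)
  have h2σ : 2 * σ ≤ π / (2 * ω) := by
    have : π / (2 * ω) = 2 * (π / (4 * ω)) := by field_simp; ring
    rw [this]; linarith
  have h2σS : 2 * σ ≤ S := h2σ.trans (h2L.le.trans hS)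
  set θ : ℝ → ℝ := fun x => (1 + cos (π * max 0 (min 1 ((x - σ) / σ)))) / 2 with hθ
  set θ' : ℝ → ℝ := fun x => -(π / σ) * sin (π * max 0 (min 1 ((x - σ) / σ))) / 2 with hθ'
  have hθC : ContDiff ℝ 1 θ := WallCutoff.contDiff_wallProfile hσ
  have hθc : Continuous θ := hθC.continuous
  have hθ01 : ∀ x, 0 ≤ θ x ∧ θ x ≤ 1 := fun x => WallCutoff.wallProfile_mem σ σ x
  have hθ1 : ∀ x, x ≤ σ → θ x = 1 := fun x hx => WallCutoff.wallProfile_of_le hσ hx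
  have hθ0 : ∀ x, 2 * σ ≤ x → θ x = 0 := fun x hx =>
    WallCutoff.wallProfile_of_ge hσ (by linarith)
  have hdθ : ∀ x, deriv θ x = θ' x := fun x => WallCutoff.deriv_wallProfile hσ x
  have hθ'c : Continuous θ' := WallCutoff.continuous_wallProfileDeriv σ σ
  have hθ'0 : ∀ x, x ∉ Ioo σ (2 * σ) → θ' x = 0 := by
    intro x hx
    rcases le_or_gt x σ with h | h
    · exact WallCutoff.wallProfileDeriv_of_le hσ h
    · exact WallCutoff.wallProfileDeriv_of_ge hσ (by
        have : ¬ x < 2 * σ := fun h' => hx ⟨h, h'⟩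
        linarith [not_lt.1 this])
  have hθ'le : ∀ x, -(π / (2 * σ)) ≤ θ' x := fun x =>
    (abs_le.1 (WallCutoff.abs_wallProfileDeriv_le hσ σ x)).1
  -- apply the weak inequality
  have key := hineq θ hθC fun x => (hθ01 x).1
  -- (a) the kinetic term dominates `∫₀^σ et`
  have hθet : IntegrableOn (fun x => θ x * et x) (Icc 0 S) :=
    het.continuousOn_mul hθc.continuousOn isCompact_Icc
  have hii : ∀ c d, 0 ≤ c → c ≤ d → d ≤ S →
      IntervalIntegrable (fun x => θ x * et x) volume c d := fun c d hc hcd hd =>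
    (hθet.mono_set (by rw [uIcc_of_le hcd]; exact Icc_subset_Icc hc hd)).intervalIntegrable
  have hσS : σ ≤ S := by linarith
  have ha : ∫ x in (0 : ℝ)..σ, et x ≤ ∫ x in (0 : ℝ)..S, θ x * et x := by
    rw [← integral_add_adjacent_intervals (hii 0 σ le_rfl hσ.le hσS) (hii σ S hσ.le hσS le_rfl)]
    have h1 : ∫ x in (0 : ℝ)..σ, θ x * et x = ∫ x in (0 : ℝ)..σ, et x := by
      refine integral_congr fun x hx => ?_
      rw [uIcc_of_le hσ.le] at hx
      simp [hθ1 x hx.2]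
    have h2 : 0 ≤ ∫ x in σ..S, θ x * et x := by
      refine integral_nonneg_of_ae_restrict hσS ?_
      have hae' := ae_restrict_of_ae_restrict_of_subset (Icc_subset_Icc hσ.le le_rfl) hae
      filter_upwards [hae'] with x hx
      exact mul_nonneg (hθ01 x).1 hx.1
    rw [h1]
    linarith
  -- (b) the mass term
  have hb : ∫ x in (0 : ℝ)..S, θ x * m x ≤ Φ * ((2 * σ) ^ 3 / 3) := by
    have hθm : Continuous fun x => θ x * m x := hθc.mul hmc
    rw [← integral_add_adjacent_intervals (hθm.intervalIntegrable 0 (2 * σ))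
      (hθm.intervalIntegrable (2 * σ) S)]
    have h1 : ∫ x in (2 * σ)..S, θ x * m x = 0 := by
      rw [integral_congr (g := fun _ => (0 : ℝ)) fun x hx => ?_, intervalIntegral.integral_zero]
      rw [uIcc_of_le h2σS] at hx
      simp [hθ0 x hx.1]
    have h2 : ∫ x in (0 : ℝ)..(2 * σ), θ x * m x ≤ ∫ x in (0 : ℝ)..(2 * σ), Φ * x ^ 2 := by
      refine integral_mono_on (by linarith) (hθm.intervalIntegrable _ _)
        ((continuous_const.mul (continuous_pow 2)).intervalIntegrable _ _) fun x hx => ?_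
      have hmx : 0 ≤ m x := hmnn x ⟨hx.1, hx.2.trans h2σS⟩
      calc θ x * m x ≤ 1 * m x := mul_le_mul_of_nonneg_right (hθ01 x).2 hmx
        _ = m x := one_mul _
        _ ≤ Φ * x ^ 2 := hmsq x ⟨hx.1, hx.2.trans h2σ⟩
    have h3 : ∫ x in (0 : ℝ)..(2 * σ), Φ * x ^ 2 = Φ * ((2 * σ) ^ 3 / 3) := by
      rw [intervalIntegral.integral_const_mul, integral_pow]; norm_num
    linarith
  -- (c) the boundary (flux) term
  have hc : -(π / (4 * σ)) * (Φ * (2 * σ) ^ 2) ≤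
      (1 / 2) * ∫ x in (0 : ℝ)..S, deriv θ x * p x := by
    have h1 : ∫ x in (0 : ℝ)..S, deriv θ x * p x = ∫ x in σ..(2 * σ), θ' x * p x := by
      simp only [hdθ]
      exact integral_eq_integral_of_forall_not_mem_Ioo hσ.le (by linarith) h2σS fun x hx => by
        rw [hθ'0 x hx, zero_mul]
    have h2 : ∫ x in σ..(2 * σ), -(π / (2 * σ)) * p x ≤ ∫ x in σ..(2 * σ), θ' x * p x := by
      refine integral_mono_on (by linarith) ((continuous_const.mul hp).intervalIntegrable _ _)
        ((hθ'c.mul hp).intervalIntegrable _ _) fun x hx => ?_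
      exact mul_le_mul_of_nonneg_right (hθ'le x) (hpnn x ⟨hσ.trans_le hx.1, hx.2.trans h2σ⟩)
    have h3 : ∫ x in σ..(2 * σ), -(π / (2 * σ)) * p x = -(π / (2 * σ)) * (m (2 * σ) - m σ) := by
      rw [intervalIntegral.integral_const_mul, integral_eq_sub_of_hasDerivAt (fun x _ => hm x)
        (hp.intervalIntegrable _ _)]
    have h4 : m (2 * σ) ≤ Φ * (2 * σ) ^ 2 := hmsq (2 * σ) ⟨by linarith, h2σ⟩
    have h5 : 0 ≤ m σ := hmnn σ ⟨hσ.le, hσS⟩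
    have h6 : 0 < π / (2 * σ) := by positivity
    rw [h1]
    have h7 : -(π / (2 * σ)) * (m (2 * σ) - m σ) ≤ ∫ x in σ..(2 * σ), θ' x * p x := h3 ▸ h2
    have h8 : (π / (2 * σ)) * (m (2 * σ) - m σ) ≤ (π / (2 * σ)) * (Φ * (2 * σ) ^ 2) :=
      mul_le_mul_of_nonneg_left (by linarith) h6.le
    have h9 : π / (4 * σ) = (1 / 2) * (π / (2 * σ)) := by field_simp; ring
    rw [h9]
    nlinarith
  -- (d) combine
  have hωσ : ω * σ ≤ π / 4 := by
    rw [le_div_iff₀ (by norm_num : (0:ℝ) < 4)]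
    calc ω * σ * 4 = (4 * ω) * σ := by ring
      _ ≤ (4 * ω) * (π / (4 * ω)) := mul_le_mul_of_nonneg_left hσ' (by positivity)
      _ = π := by field_simp
  have hωσ0 : 0 ≤ ω * σ := by positivity
  have htot : ∫ x in (0 : ℝ)..σ, et x ≤
      ω ^ 2 * (Φ * ((2 * σ) ^ 3 / 3)) + π / (4 * σ) * (Φ * (2 * σ) ^ 2) := by
    have := mul_le_mul_of_nonneg_left hb (sq_nonneg ω)
    linarith
  have hrhs : ω ^ 2 * (Φ * ((2 * σ) ^ 3 / 3)) + π / (4 * σ) * (Φ * (2 * σ) ^ 2) =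
      Φ * σ * (8 * (ω * σ) ^ 2 / 3 + π) := by
    field_simp
    ring
  have hfin : Φ * σ * (8 * (ω * σ) ^ 2 / 3 + π) ≤ Φ * σ * (8 * (π / 4) ^ 2 / 3 + π) := by
    have : (ω * σ) ^ 2 ≤ (π / 4) ^ 2 := pow_le_pow_left₀ hωσ0 hωσ 2
    have hΦσ : 0 ≤ Φ * σ := mul_nonneg hΦnn hσ.le
    nlinarith
  have hid : Φ * σ * (8 * (π / 4) ^ 2 / 3 + π) = (4 + 2 * π / 3) * ω ^ 3 * η * σ := by
    rw [hΦ]; field_simp; ring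
  linarith

/-- **Continuous representative of the marginal slope (du Bois-Reymond).** If `m` is continuous
on `[0, S]` with `m = ∫₀ p` there (`p, e` integrable) and the local virial identity
`∫₀^S g e + ½ ∫₀^S g' p = E' ∫₀^S g m` holds for every `C¹` test function `g`, then `p` agrees
a.e. on `[0, S]` with the continuous function `p̄ = 2∫₀(e - E'm)` and `m = ∫₀ p̄` is `C¹` with
`m' = p̄`: packaged as the existence of `p̄` continuous and `m̄` with `m̄' = p̄` everywhere,
`m̄ = m` on `[0, S]`, `p = p̄` a.e. on `[0, S]` (tree lemma
`Literature.Analysis.FunctionSpaces.ae_eq_add_setIntegral_of_forall_test`).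
[cite: Brezis2011, Lemma 8.1] -/
theorem exists_continuous_slope {S E' : ℝ} {m p e : ℝ → ℝ} (hS : 0 < S)
    (hmc : ContinuousOn m (Icc 0 S)) (hpi : IntegrableOn p (Icc 0 S))
    (hei : IntegrableOn e (Icc 0 S)) (hmp : ∀ s ∈ Icc 0 S, m s = ∫ x in (0 : ℝ)..s, p x)
    (hvir : ∀ g : ℝ → ℝ, ContDiff ℝ 1 g →
      (∫ s in (0 : ℝ)..S, g s * e s) + (1 / 2) * (∫ s in (0 : ℝ)..S, deriv g s * p s) =
        E' * ∫ s in (0 : ℝ)..S, g s * m s) :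
    ∃ pbar mbar : ℝ → ℝ, Continuous pbar ∧ (∀ t, HasDerivAt mbar (pbar t) t) ∧
      (∀ s ∈ Icc 0 S, mbar s = m s) ∧ (∀ᵐ t ∂(volume.restrict (Icc 0 S)), p t = pbar t) := by
  have hmi : IntegrableOn m (Icc 0 S) := hmc.integrableOn_compact isCompact_Icc
  set F : ℝ → ℝ := fun x => e x - E' * m x with hF
  have hFi : IntegrableOn F (Icc 0 S) := hei.sub (hmi.const_mul E')
  have hFi' : IntegrableOn F (Ioo 0 S) := hFi.mono_set Ioo_subset_Icc_self
  have hIoo : ∀ f : ℝ → ℝ, ∫ s in Ioo 0 S, f s = ∫ s in (0 : ℝ)..S, f s := fun f => by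
    rw [integral_of_le hS.le, setIntegral_congr_set (Ioo_ae_eq_Ioc (μ := volume))]
  -- du Bois-Reymond with `U = p/2`, `c = 0`
  have hdBR := Literature.Analysis.FunctionSpaces.ae_eq_add_setIntegral_of_forall_test
    (T := S) (c := 0) (U := fun t => p t / 2) (F := F)
    ((hpi.mono_set Ioo_subset_Icc_self).div_const 2) hFi' fun η hη hsupp _ => by
      have hη1 : ContDiff ℝ 1 η := hη.of_le (by exact_mod_cast le_top)
      have hηc : Continuous η := hη.continuous
      have hη'c : Continuous (deriv η) := hη1.continuous_deriv le_rfl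
      have hi1 : IntegrableOn (fun s => deriv η s * (p s / 2)) (Ioo 0 S) :=
        Literature.Analysis.FunctionSpaces.integrableOn_continuous_mul_of_hasCompactSupport
          ((hpi.mono_set Ioo_subset_Icc_self).div_const 2) hη'c hsupp.deriv
      have hi2 : IntegrableOn (fun s => η s * F s) (Ioo 0 S) :=
        Literature.Analysis.FunctionSpaces.integrableOn_continuous_mul_of_hasCompactSupport
          hFi' hηc hsupp
      have hi3 : IntegrableOn (fun s => η s * e s) (Ioo 0 S) :=
        Literature.Analysis.FunctionSpaces.integrableOn_continuous_mul_of_hasCompactSupport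
          (hei.mono_set Ioo_subset_Icc_self) hηc hsupp
      have hi4 : IntegrableOn (fun s => η s * m s) (Ioo 0 S) :=
        Literature.Analysis.FunctionSpaces.integrableOn_continuous_mul_of_hasCompactSupport
          (hmi.mono_set Ioo_subset_Icc_self) hηc hsupp
      have e1 : ∫ s in Ioo 0 S, deriv η s * (p s / 2) =
          (1 / 2) * ∫ s in (0 : ℝ)..S, deriv η s * p s := by
        rw [← hIoo, ← MeasureTheory.integral_const_mul]
        refine setIntegral_congr_fun measurableSet_Ioo fun x _ => ?_
        ring
      have e2 : ∫ s in Ioo 0 S, η s * F s =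
          (∫ s in (0 : ℝ)..S, η s * e s) - E' * ∫ s in (0 : ℝ)..S, η s * m s := by
        rw [← hIoo, ← hIoo, ← MeasureTheory.integral_const_mul,
          ← integral_sub hi3 (hi4.const_mul E')]
        refine setIntegral_congr_fun measurableSet_Ioo fun x _ => ?_
        simp only [hF]
        ring
      rw [integral_add hi1 hi2, e1, e2, mul_zero, add_zero]
      linarith [hvir η hη1]
  -- the continuous representative
  set F₀ : ℝ → ℝ := (Ioo 0 S).indicator F with hF₀
  have hF₀i : Integrable F₀ := hFi'.integrable_indicator measurableSet_Ioo
  set pbar : ℝ → ℝ := fun t => 2 * ∫ x in (0 : ℝ)..t, F₀ x with hpbar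
  have hpc : Continuous pbar :=
    continuous_const.mul (continuous_primitive (fun a b => hF₀i.intervalIntegrable) 0)
  have hpbar_eq : ∀ t ∈ Ioo 0 S, pbar t = 2 * ∫ s in Ioc 0 t, F s := fun t ht => by
    simp only [hpbar]
    rw [integral_of_le ht.1.le, setIntegral_congr_fun measurableSet_Ioc fun x hx => ?_]
    exact indicator_of_mem (show x ∈ Ioo 0 S from ⟨hx.1, hx.2.trans_lt ht.2⟩) F
  have hae_p : ∀ᵐ t ∂(volume.restrict (Icc 0 S)), p t = pbar t := by
    have h1 : ∀ᵐ t ∂(volume.restrict (Ioo 0 S)), p t = pbar t := by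
      filter_upwards [hdBR, ae_restrict_mem measurableSet_Ioo] with t ht htm
      rw [hpbar_eq t htm]
      linarith
    rwa [Measure.restrict_congr_set (Ioo_ae_eq_Icc (μ := volume))] at h1
  set mbar : ℝ → ℝ := fun t => ∫ x in (0 : ℝ)..t, pbar x with hmbar
  have hd : ∀ t, HasDerivAt mbar (pbar t) t := fun t =>
    (hpc.integral_hasStrictDerivAt 0 t).hasDerivAt
  have hmbar_eq : ∀ s ∈ Icc 0 S, mbar s = m s := fun s hs => by
    rw [hmp s hs]
    refine integral_congr_ae ?_
    have h := (ae_restrict_iff' measurableSet_Icc).1 hae_p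
    filter_upwards [h] with x hx hxm
    rw [uIoc_of_le hs.1] at hxm
    exact (hx ⟨hxm.1.le, hxm.2.trans hs.2⟩).symm
  exact ⟨pbar, mbar, hpc, hd, hmbar_eq, hae_p⟩

/-- **The marginal Sturm package** (the form consumed on the problem side). Wall at `s = 0`,
box up to `S`; `m ≥ 0` continuous on `[0, S]` with `m(0) = 0`, `m = ∫₀ p`; normal slice kinetic
energy `et ≥ 0` and full slice energy `e ≥ et` (integrable) with `p² ≤ 4 m·et` a.e.; the local
virial identity `∫g e + ½∫g' p = E' ∫g m` for all `C¹` test functions `g`; the slice bound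
`∫g et + E₁ ∫g m ≤ ∫g e` for `g ≥ 0`; `E' - E₁ ≤ μ`; slab mass `∫₀^{2s₀} m ≤ η`, `s₀ = π/(2√μ)`,
`2s₀ ≤ S`. Conclusion: `∫₀^σ et ≤ 8 μ^{3/2} η σ` for `0 < σ ≤ s₀/2` (indeed with `4 + 2π/3` in
place of `8`). Proof: du Bois-Reymond (`exists_continuous_slope`) makes `m` a `C¹` function with
continuous slope `p̄ = p` a.e.; the two `g`-hypotheses combine to the weak subsolution inequality
`∫g et + ½∫g' p̄ ≤ μ ∫g m`; conclude by `integral_le_of_weak_subsolution`. [folklore] -/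
theorem integral_normalKinetic_le (S μ η E' E₁ : ℝ) (m p et e : ℝ → ℝ) (hμ : 0 < μ)
    (hη : 0 ≤ η) (hE : E' - E₁ ≤ μ) (hS : 2 * (π / (2 * Real.sqrt μ)) ≤ S)
    (hmc : ContinuousOn m (Icc 0 S)) (hm0 : m 0 = 0) (hmnn : ∀ s ∈ Icc 0 S, 0 ≤ m s)
    (hpi : IntegrableOn p (Icc 0 S)) (heti : IntegrableOn et (Icc 0 S))
    (hei : IntegrableOn e (Icc 0 S)) (hmp : ∀ s ∈ Icc 0 S, m s = ∫ x in (0 : ℝ)..s, p x)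
    (hae : ∀ᵐ s ∂(volume.restrict (Icc 0 S)), 0 ≤ et s ∧ et s ≤ e s ∧ p s ^ 2 ≤ 4 * m s * et s)
    (hvir : ∀ g : ℝ → ℝ, ContDiff ℝ 1 g →
      (∫ s in (0 : ℝ)..S, g s * e s) + (1 / 2) * (∫ s in (0 : ℝ)..S, deriv g s * p s) =
        E' * ∫ s in (0 : ℝ)..S, g s * m s)
    (hslice : ∀ g : ℝ → ℝ, ContDiff ℝ 1 g → (∀ s, 0 ≤ g s) →
      (∫ s in (0 : ℝ)..S, g s * et s) + E₁ * (∫ s in (0 : ℝ)..S, g s * m s) ≤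
        ∫ s in (0 : ℝ)..S, g s * e s)
    (hmass : (∫ s in (0 : ℝ)..(2 * (π / (2 * Real.sqrt μ))), m s) ≤ η)
    {σ : ℝ} (hσ : 0 < σ) (hσ' : σ ≤ π / (2 * Real.sqrt μ) / 2) :
    (∫ s in (0 : ℝ)..σ, et s) ≤ 8 * μ * Real.sqrt μ * η * σ := by
  set ω : ℝ := Real.sqrt μ with hωdef
  have hω : 0 < ω := sqrt_pos.2 hμ
  have hω2 : ω ^ 2 = μ := sq_sqrt hμ.le
  have hL : 2 * (π / (2 * ω)) = π / ω := by field_simp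
  rw [hL] at hS hmass
  have hS0 : 0 < S := (div_pos pi_pos hω).trans_le hS
  obtain ⟨pbar, mbar, hpc, hd, hmbar_eq, hae_p⟩ := exists_continuous_slope hS0 hmc hpi hei hmp hvir
  -- transport the hypotheses to the regular data `(mbar, pbar)`
  have hmbar0 : mbar 0 = 0 := by rw [hmbar_eq 0 ⟨le_rfl, hS0.le⟩, hm0]
  have hmbar_nn : ∀ x ∈ Icc 0 S, 0 ≤ mbar x := fun x hx => by rw [hmbar_eq x hx]; exact hmnn x hx
  have hae' : ∀ᵐ x ∂(volume.restrict (Icc 0 S)), 0 ≤ et x ∧ pbar x ^ 2 ≤ 4 * mbar x * et x := by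
    filter_upwards [hae, hae_p, ae_restrict_mem measurableSet_Icc] with x hx hpx hxm
    rw [← hpx, hmbar_eq x hxm]
    exact ⟨hx.1, hx.2.2⟩
  have hcongr_m : ∀ (g : ℝ → ℝ) (T : ℝ), 0 ≤ T → T ≤ S →
      ∫ x in (0 : ℝ)..T, g x * mbar x = ∫ x in (0 : ℝ)..T, g x * m x := fun g T hT hTS => by
    refine integral_congr fun x hx => ?_
    rw [uIcc_of_le hT] at hx
    simp [hmbar_eq x ⟨hx.1, hx.2.trans hTS⟩]
  have hineq : ∀ g : ℝ → ℝ, ContDiff ℝ 1 g → (∀ x, 0 ≤ g x) →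
      (∫ x in (0 : ℝ)..S, g x * et x) + (1 / 2) * (∫ x in (0 : ℝ)..S, deriv g x * pbar x) ≤
        ω ^ 2 * ∫ x in (0 : ℝ)..S, g x * mbar x := by
    intro g hg hg0
    have e1 : ∫ x in (0 : ℝ)..S, deriv g x * pbar x = ∫ x in (0 : ℝ)..S, deriv g x * p x := by
      refine integral_congr_ae ?_
      have h := (ae_restrict_iff' measurableSet_Icc).1 hae_p
      filter_upwards [h] with x hx hxm
      rw [uIoc_of_le hS0.le] at hxm
      rw [hx ⟨hxm.1.le, hxm.2⟩]
    rw [e1, hcongr_m g S hS0.le le_rfl, hω2]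
    have h1 := hvir g hg
    have h2 := hslice g hg hg0
    have h3 : 0 ≤ ∫ x in (0 : ℝ)..S, g x * m x :=
      integral_nonneg hS0.le fun x hx => mul_nonneg (hg0 x) (hmnn x hx)
    have h4 := mul_le_mul_of_nonneg_right hE h3
    nlinarith
  have hmass' : ∫ x in (0 : ℝ)..(π / ω), mbar x ≤ η := by
    have := hcongr_m (fun _ => 1) (π / ω) (div_pos pi_pos hω).le hS
    simp only [one_mul] at this
    rwa [this]
  have hσ'' : σ ≤ π / (4 * ω) := by
    have : π / (2 * ω) / 2 = π / (4 * ω) := by field_simp; ring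
    rwa [this] at hσ'
  have hmain := integral_le_of_weak_subsolution hω hS hpc hd hmbar0 hmbar_nn heti hae' hineq
    hmass' hσ hσ''
  have hω3 : ω ^ 3 = μ * ω := by rw [← hω2]; ring
  rw [hω3] at hmain
  have hπ : 4 + 2 * π / 3 ≤ 8 := by linarith [pi_le_four]
  have hnn : 0 ≤ μ * ω * η * σ := by positivity
  nlinarith

end MarginalSturm

end Literature.MathematicalPhysics.QuantumManyBody.BoseGas
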